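import Summits.AtomisticToContinuum.BoseEinsteinCondensation.Theorems.BoxCountShadowB
import HarnessLib

/-!
# BoxCountShadowNumberMarker — lens-6 gen 41: window number filters kill the SUF side (label half, certified)

Cell `decomp-a2c`, lens 6 «barrier-complement carving», conjunct `BoseEinsteinCondensation`, box line
(stmt-AtomisticToContinuum-27506).  Continuation of `BoxCountShadowB` (same namespace).  This file CERTIFIES, over the
tree's objects `sliceSq` (`P̂`), `blockMass` (`q_B`), `labelAffinity`, `countAffinity`, the label-side half of the
gen-41 witness against every energy-class route to SUF_h / DEC_h / FHT_h (`BoxCountShadowMarkerCost`,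
`LowEnergyHorizonFibreTail` FALSE-type):

**Window-filtered states.**  Group the `K³` blocks of side `ℓ = L/K` into super-blocks (`grp : blocks → ℕ`,
at most `m` blocks per group; `m = 1` = single horizon cells, `m = k³` = cubes of side `kℓ`).  `Φ : (ℝ³)^{n+1} → ℝ`
is WINDOW-FILTERED when to each block `B` there is a core profile `χ_B : ℝ³ → ℝ` supported in the union of the cells
of `B`'s group (`hsupp`), a window centre `c_B` and a common half-width `τ` with `2τ ≤ 1` (`hτ`) such that on the
support of `Φ` every smeared count `s_B(X) = Σ_i χ_B(x_i)` lies in the open window `|s_B(X) − c_B| < τ` (`hwin`).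
Example: `Φ = Φ₀ · Π_g f_g(s_g)` with `f_g` supported in the window — the number filters of
`Theses/NumberFilterBlindness` (FilterFragmentation), on SMOOTH intra-group counts, at any scale from one horizon cell
(`m = 1`) up to a fixed fraction of the box (`k = K/k₀`).

**What is proved (0 sorry).**
* `slice_eq_zero_of_window`, `blockMass_eq_zero_of_window`: if the others `Y` have `s_B(Y) ≤ c_B − τ` for some block
  `B` (one smeared unit short of the window) then `Φ(x, Y) = 0` for every `x` outside `B`'s group: the tagged
  particle's GROUP is DETERMINED by `Y` (`mem_groupDetermined_of_window`); and a tagged particle in a CORE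
  (`χ_B(x) = 1`) forces exactly this (`smearedCount_le_of_core`).
* `labelAffinity_le_of_groupDetermined` (abstract, any `Φ`, any grouping): `labelAffinity ≤ ∫_{Aᶜ} P̂ +
  m^{1/2} K^{-3/2} ∫_A P̂`, `A` = the set of `Y` whose slice lives in one group (`groupDetermined`, measurable;
  Cauchy–Schwarz inside the group).
* `sliceSq_eq_nonCore_of_not_mem`, `setLIntegral_sliceSq_compl_le_nonCoreMass`: off `A` the slice carries no core
  mass, so `∫_{Aᶜ} P̂ ≤ nonCoreMass` (the joint mass of «tagged particle outside every core»).
* `labelAffinity_le_nonCoreMass_add` (THE CERTIFICATE): for every window-filtered `Φ`,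
  `labelAffinity ≤ nonCoreMass + m^{1/2} K^{-3/2} · ∫ P̂`; so along a window-filtered COUNT-TOLERANT
  (`countAffinity ≥ 1/2`) normalised family with `nonCoreMass → 0` and `m^{1/2} K^{-3/2} → 0` (single cells: `K → ∞`;
  super-blocks of side `L/k₀`: `k₀^{-3/2}`), no SUF-type inequality `s · countAffinity ≤ labelAffinity` with a fixed
  `s > 0` survives — and the DEC/FHT conclusions fail with it, by the statewise door `labelAffinity_ge_of_fibreTailAt`
  of `BoxCountShadowMarkerCost`, whose negative edge `not_lowEnergyHorizonFibreTail_of_windowFilterFamily` consumes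
  exactly this certificate.
The two remaining halves of the witness — that window-filtered families with `nonCoreMass → 0` exist at energy
`≤ 4πaρN(1 + ε)` (pointwise IMS: total cost `≤ 36 C_f k₀² ρL/(1 − p'') = O(N^{1/3})` for super-blocks of side `L/k₀`,
`O(ρ^{2η} N/(aM²(1 − p'')))·4πaρ` for single cells [CyconEtAl1987, Thm. 3.2]) and are count-tolerant (graded layer of
`≫ 1` particles per group) — are the computations §E, §C of NODE-MarkerCost.md; they are not formalised here.
No instances, no notation, no sorry.
-/

open MeasureTheory Filter Set
open scoped ENNReal NNReal BigOperators

namespace Summit.AtomisticToContinuum.BoseEinsteinCondensation.Theorems.BoxCountShadow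

open Literature.MathematicalPhysics.QuantumManyBody.BoseGas
open Summit.AtomisticToContinuum.BoseEinsteinCondensation.Theorems.BoxLatticeFSum
open Summit.AtomisticToContinuum.BoseEinsteinCondensation.Theorems.BoxLabelAffinity
open Summit.AtomisticToContinuum.BoseEinsteinCondensation.Theorems.BoxHorizonAffinity

variable {n : ℕ}

/-! ### §15  Smeared counts, window-filtered states, the group-determined set -/

/-- The SMEARED COUNT `s_χ(X) = Σ_i χ(x_i)` of a one-body profile `χ` over a configuration. [folklore] -/
def smearedCount {N : ℕ} (χ : Space → ℝ) (X : Config N) : ℝ := ∑ i : Fin N, χ (X i)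

/-- `s_χ(x, Y) = χ(x) + s_χ(Y)`. [folklore] -/
theorem smearedCount_vecCons (χ : Space → ℝ) (x : Space) (Y : Config n) :
    smearedCount χ (Matrix.vecCons x Y) = χ x + smearedCount χ Y := by
  simp [smearedCount, Fin.sum_univ_succ, Matrix.cons_val_zero, Matrix.cons_val_succ]

/-! **Window-filtered states** (hypotheses, not a structure): a grouping `grp` of the blocks (fibres of size `≤ m`,
`hcard`), core profiles `χ_B` vanishing off the union of the cells of `B`'s group (`hsupp`), measurable (`hχm`), window
centres `c_B`, half-width `τ` with `2τ ≤ 1` (`hτ`), and on the support of `Φ` every smeared count in its open window,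
`Φ(X) ≠ 0 ⇒ |Σ_i χ_B(x_i) − c_B| < τ` (`hwin`).  The filtered states `Φ₀ · Π f(Σ_i χ(x_i))` with `supp f ⊆ (c − τ, c + τ)`
satisfy them; nothing else about `Φ` is assumed. -/

/-- **The group-determined set** `A = {Y : ∃ B₀, ∀ B with grp B ≠ grp B₀, q_B(Y) = 0}` of a GROUPING
`grp : blocks → ℕ` of the `K³` blocks (blocks with equal label form one group — a super-block; `grp` injective =
single blocks): environments for which the slice `x ↦ Φ(x, Y)²` puts no mass outside a single group of blocks.
[folklore] -/
def groupDetermined (L : ℝ) (K : ℕ) (grp : SubIdx K → ℕ) (Φ : Config (n + 1) → ℝ) : Set (Config n) :=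
  ⋃ B₀ : SubIdx K, ⋂ B : SubIdx K, ⋂ (_ : grp B ≠ grp B₀), blockMass L K Φ B ⁻¹' {0}

/-- Membership in the group-determined set. [folklore] -/
theorem mem_groupDetermined {L : ℝ} {K : ℕ} {grp : SubIdx K → ℕ} {Φ : Config (n + 1) → ℝ} {Y : Config n} :
    Y ∈ groupDetermined L K grp Φ ↔
      ∃ B₀ : SubIdx K, ∀ B : SubIdx K, grp B ≠ grp B₀ → blockMass L K Φ B Y = 0 := by
  simp [groupDetermined, Set.mem_iUnion, Set.mem_iInter]

/-- The group-determined set is measurable (for measurable `Φ`). [folklore] -/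
theorem measurableSet_groupDetermined (L : ℝ) (K : ℕ) (grp : SubIdx K → ℕ) {Φ : Config (n + 1) → ℝ}
    (hΦm : Measurable Φ) : MeasurableSet (groupDetermined L K grp Φ) :=
  MeasurableSet.iUnion fun _ => MeasurableSet.iInter fun B => MeasurableSet.iInter fun _ =>
    measurable_blockMass L K hΦm B (measurableSet_singleton 0)

/-- The CORE SET `{x : ∃ B, χ_B(x) = 1}` of a family of core profiles. [folklore] -/
def coreSet (K : ℕ) (χ : SubIdx K → Space → ℝ) : Set Space := ⋃ B : SubIdx K, χ B ⁻¹' {1}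

/-- The core set is measurable. [folklore] -/
theorem measurableSet_coreSet {K : ℕ} {χ : SubIdx K → Space → ℝ} (hχm : ∀ B, Measurable (χ B)) :
    MeasurableSet (coreSet K χ) :=
  MeasurableSet.iUnion fun B => hχm B (measurableSet_singleton 1)

/-- The NON-CORE MASS `∫∫_{x ∉ core} Φ(x, Y)² dx dY` (for normalised symmetric `Φ`: the probability that the tagged
particle sits in a transition layer or outside every core). [folklore] -/
noncomputable def nonCoreMass (K : ℕ) (χ : SubIdx K → Space → ℝ) (Φ : Config (n + 1) → ℝ) : ℝ≥0∞ :=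
  ∫⁻ Y : Config n, ∫⁻ x in (coreSet K χ)ᶜ, ENNReal.ofReal (Φ (Matrix.vecCons x Y)) ^ 2

/-! ### §16  The abstract label bound on the group-determined set -/

/-- `x^{1/2} · x^{1/2} = x` in `ℝ≥0∞`. [folklore] -/
private theorem rpow_half_mul_rpow_half (x : ℝ≥0∞) : x ^ (1 / 2 : ℝ) * x ^ (1 / 2 : ℝ) = x := by
  rw [← ENNReal.rpow_add_of_nonneg (1 / 2 : ℝ) (1 / 2 : ℝ) (by norm_num) (by norm_num)]; norm_num

/-- Pointwise Cauchy–Schwarz: `Σ_B K^{-3/2} q_B(Y)^{1/2} ≤ P̂(Y)^{1/2}`. [folklore] -/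
theorem sum_blockWeight_mul_rpow_half_le {L : ℝ} {K : ℕ} (hL : 0 < L) (hK : 0 < K)
    {Φ : Config (n + 1) → ℝ} (hΦm : Measurable Φ) (Y : Config n) :
    ∑ B : SubIdx K, blockWeight K * blockMass L K Φ B Y ^ (1 / 2 : ℝ) ≤ sliceSq Φ Y ^ (1 / 2 : ℝ) := by
  calc ∑ B : SubIdx K, blockWeight K * blockMass L K Φ B Y ^ (1 / 2 : ℝ)
      ≤ (∑ _B : SubIdx K, blockWeight K ^ 2) ^ (1 / 2 : ℝ) *
          (∑ B : SubIdx K, blockMass L K Φ B Y) ^ (1 / 2 : ℝ) := sum_mul_rpow_half_le _ _ _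
    _ ≤ 1 * sliceSq Φ Y ^ (1 / 2 : ℝ) := by
        rw [sum_blockWeight_sq hK, ENNReal.one_rpow]
        exact mul_le_mul' le_rfl (ENNReal.rpow_le_rpow (sum_blockMass_le_sliceSq hL hK hΦm Y) (by norm_num))
    _ = sliceSq Φ Y ^ (1 / 2 : ℝ) := one_mul _

/-- On the group-determined set only one group (of at most `m` blocks) contributes, and Cauchy–Schwarz over that
group gives `Σ_B K^{-3/2} q_B(Y)^{1/2} ≤ m^{1/2} K^{-3/2} P̂(Y)^{1/2}` (`m = 1`: single blocks, `K^{-3/2}`; `m = k³`: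
super-blocks of side `kℓ`, `(k/K)^{3/2}`). [folklore] -/
theorem sum_blockWeight_mul_rpow_half_le_of_mem {L : ℝ} {K : ℕ} (hL : 0 < L) (hK : 0 < K)
    {Φ : Config (n + 1) → ℝ} (hΦm : Measurable Φ) {grp : SubIdx K → ℕ} {m : ℕ}
    (hcard : ∀ B₀ : SubIdx K, (Finset.univ.filter fun B => grp B = grp B₀).card ≤ m)
    {Y : Config n} (hY : Y ∈ groupDetermined L K grp Φ) :
    ∑ B : SubIdx K, blockWeight K * blockMass L K Φ B Y ^ (1 / 2 : ℝ) ≤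
      (m : ℝ≥0∞) ^ (1 / 2 : ℝ) * blockWeight K * sliceSq Φ Y ^ (1 / 2 : ℝ) := by
  obtain ⟨B₀, hB₀⟩ := mem_groupDetermined.1 hY
  have hsplit := Finset.sum_filter_add_sum_filter_not Finset.univ (fun B => grp B = grp B₀)
    (fun B => blockWeight K * blockMass L K Φ B Y ^ (1 / 2 : ℝ))
  have hzero : ∑ B ∈ Finset.univ.filter (fun B => ¬ grp B = grp B₀),
      blockWeight K * blockMass L K Φ B Y ^ (1 / 2 : ℝ) = 0 :=
    Finset.sum_eq_zero fun B hB => by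
      rw [hB₀ B (Finset.mem_filter.1 hB).2, ENNReal.zero_rpow_of_pos (by norm_num), mul_zero]
  have hw2 : (blockWeight K ^ 2) ^ (1 / 2 : ℝ) = blockWeight K := by
    rw [← ENNReal.rpow_two, ← ENNReal.rpow_mul]; norm_num
  rw [← hsplit, hzero, add_zero]
  calc ∑ B ∈ Finset.univ.filter (fun B => grp B = grp B₀), blockWeight K * blockMass L K Φ B Y ^ (1 / 2 : ℝ)
      ≤ (∑ _B ∈ Finset.univ.filter (fun B => grp B = grp B₀), blockWeight K ^ 2) ^ (1 / 2 : ℝ) *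
          (∑ B ∈ Finset.univ.filter (fun B => grp B = grp B₀), blockMass L K Φ B Y) ^ (1 / 2 : ℝ) :=
        sum_mul_rpow_half_le _ _ _
    _ ≤ ((m : ℝ≥0∞) * blockWeight K ^ 2) ^ (1 / 2 : ℝ) * sliceSq Φ Y ^ (1 / 2 : ℝ) := by
        refine mul_le_mul' (ENNReal.rpow_le_rpow ?_ (by norm_num)) (ENNReal.rpow_le_rpow ?_ (by norm_num))
        · rw [Finset.sum_const, nsmul_eq_mul]
          exact mul_le_mul' (by exact_mod_cast hcard B₀) le_rfl
        · exact (Finset.sum_le_sum_of_subset_of_nonneg (Finset.filter_subset _ _) fun _ _ _ => bot_le).trans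
            (sum_blockMass_le_sliceSq hL hK hΦm Y)
    _ = (m : ℝ≥0∞) ^ (1 / 2 : ℝ) * blockWeight K * sliceSq Φ Y ^ (1 / 2 : ℝ) := by
        rw [ENNReal.mul_rpow_of_nonneg _ _ (by norm_num : (0 : ℝ) ≤ 1 / 2), hw2]

/-- `K^{-3/2} ≤ 1`. [folklore] -/
theorem blockWeight_le_one {K : ℕ} (hK : 0 < K) : blockWeight K ≤ 1 := by
  unfold blockWeight
  refine ENNReal.ofReal_le_one.2 (pow_le_one₀ (Real.sqrt_nonneg _) (Real.sqrt_le_one.2 ?_))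
  rw [div_le_one (by exact_mod_cast hK)]
  exact_mod_cast hK

/-- `m^{1/2} K^{-3/2}` is finite. [folklore] -/
theorem groupWeight_ne_top {K : ℕ} (hK : 0 < K) (m : ℕ) : (m : ℝ≥0∞) ^ (1 / 2 : ℝ) * blockWeight K ≠ ⊤ :=
  ENNReal.mul_ne_top (ENNReal.rpow_ne_top_of_nonneg (by norm_num) (ENNReal.natCast_ne_top m))
    ((blockWeight_le_one hK).trans_lt ENNReal.one_lt_top).ne

/-- **Abstract label bound** (any measurable `Φ`, any grouping with groups of at most `m` blocks):
`labelAffinity ≤ ∫_{Aᶜ} P̂ + m^{1/2} K^{-3/2} ∫_A P̂` with `A` the group-determined set — on `A` the conditional block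
law of the tagged particle lives on one group (affinity `≤ m^{1/2} K^{-3/2}` to the uniform law), elsewhere the
affinity is at most `1`. [folklore] -/
theorem labelAffinity_le_of_groupDetermined {L : ℝ} {K : ℕ} (hL : 0 < L) (hK : 0 < K)
    {Φ : Config (n + 1) → ℝ} (hΦm : Measurable Φ) {grp : SubIdx K → ℕ} {m : ℕ}
    (hcard : ∀ B₀ : SubIdx K, (Finset.univ.filter fun B => grp B = grp B₀).card ≤ m) :
    labelAffinity L K Φ ≤ (∫⁻ Y in (groupDetermined L K grp Φ)ᶜ, sliceSq Φ Y) +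
      (m : ℝ≥0∞) ^ (1 / 2 : ℝ) * blockWeight K * ∫⁻ Y in groupDetermined L K grp Φ, sliceSq Φ Y := by
  have hA := measurableSet_groupDetermined L K grp hΦm
  unfold labelAffinity
  rw [← lintegral_add_compl _ hA, add_comm]
  refine add_le_add ?_ ?_
  · refine setLIntegral_mono' hA.compl fun Y _ => ?_
    calc sliceSq Φ Y ^ (1 / 2 : ℝ) * ∑ B : SubIdx K, blockWeight K * blockMass L K Φ B Y ^ (1 / 2 : ℝ)
        ≤ sliceSq Φ Y ^ (1 / 2 : ℝ) * sliceSq Φ Y ^ (1 / 2 : ℝ) :=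
          mul_le_mul' le_rfl (sum_blockWeight_mul_rpow_half_le hL hK hΦm Y)
      _ = sliceSq Φ Y := rpow_half_mul_rpow_half _
  · rw [← lintegral_const_mul' _ _ (groupWeight_ne_top hK m)]
    refine setLIntegral_mono' hA fun Y hY => ?_
    calc sliceSq Φ Y ^ (1 / 2 : ℝ) * ∑ B : SubIdx K, blockWeight K * blockMass L K Φ B Y ^ (1 / 2 : ℝ)
        ≤ sliceSq Φ Y ^ (1 / 2 : ℝ) * ((m : ℝ≥0∞) ^ (1 / 2 : ℝ) * blockWeight K * sliceSq Φ Y ^ (1 / 2 : ℝ)) :=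
          mul_le_mul' le_rfl (sum_blockWeight_mul_rpow_half_le_of_mem hL hK hΦm hcard hY)
      _ = (m : ℝ≥0∞) ^ (1 / 2 : ℝ) * blockWeight K * sliceSq Φ Y := by
          rw [mul_left_comm, rpow_half_mul_rpow_half]

/-! ### §17  Window filters on (super-)block counts determine the group of a core particle -/

section Window

variable {L : ℝ} {K : ℕ} {grp : SubIdx K → ℕ} {m : ℕ} {χ : SubIdx K → Space → ℝ} {c : SubIdx K → ℝ} {τ : ℝ}
  {Φ : Config (n + 1) → ℝ}

/-! Hypothesis shapes used below (a grouping `grp : SubIdx K → ℕ` of the blocks into super-blocks with at most `m`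
blocks each, `hcard`; to each block `B` a smeared-count profile `χ_B` supported in the union of the cells of `B`'s group —
typically the same profile for all blocks of a group):
`hχm : ∀ B, Measurable (χ B)` · `hsupp : ∀ B x, (∀ B', grp B' = grp B → x ∉ subCell (L / K) B') → χ B x = 0` ·
`hτ : 2 * τ ≤ 1` · `hwin : ∀ B X, Φ X ≠ 0 → |smearedCount (χ B) X - c B| < τ`. -/

/-- One smeared unit short of the window of block `B₀`'s profile ⇒ the slice vanishes off `B₀`'s group. [folklore] -/
theorem slice_eq_zero_of_window
    (hsupp : ∀ B x, (∀ B', grp B' = grp B → x ∉ subCell (L / (K : ℝ)) B') → χ B x = 0)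
    (hwin : ∀ (B : SubIdx K) (X : Config (n + 1)), Φ X ≠ 0 → |smearedCount (χ B) X - c B| < τ)
    {B₀ : SubIdx K} {Y : Config n} (hY : smearedCount (χ B₀) Y ≤ c B₀ - τ) {x : Space}
    (hx : ∀ B', grp B' = grp B₀ → x ∉ subCell (L / (K : ℝ)) B') : Φ (Matrix.vecCons x Y) = 0 := by
  by_contra h
  have hw := hwin B₀ _ h
  rw [smearedCount_vecCons, hsupp B₀ x hx, zero_add] at hw
  have := (abs_lt.1 hw).1
  linarith

/-- One smeared unit short of the window of `B₀`'s profile ⇒ every block mass OUTSIDE `B₀`'s group vanishes.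
[folklore] -/
theorem blockMass_eq_zero_of_window (hL : 0 < L) (hK : 0 < K)
    (hsupp : ∀ B x, (∀ B', grp B' = grp B → x ∉ subCell (L / (K : ℝ)) B') → χ B x = 0)
    (hwin : ∀ (B : SubIdx K) (X : Config (n + 1)), Φ X ≠ 0 → |smearedCount (χ B) X - c B| < τ)
    {B₀ : SubIdx K} {Y : Config n} (hY : smearedCount (χ B₀) Y ≤ c B₀ - τ) {B : SubIdx K}
    (hB : grp B ≠ grp B₀) : blockMass L K Φ B Y = 0 := by
  have hℓ : 0 < L / (K : ℝ) := div_pos hL (by exact_mod_cast hK)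
  unfold blockMass
  refine setLIntegral_eq_zero (measurableSet_subCell _ B) fun x hx => ?_
  have hx' : ∀ B', grp B' = grp B₀ → x ∉ subCell (L / (K : ℝ)) B' := fun B' hB' =>
    not_mem_subCell_of_ne hℓ (fun hBB' : B = B' => hB (by rw [hBB']; exact hB')) hx
  simp [slice_eq_zero_of_window hsupp hwin hY hx']

/-- One smeared unit short of a window ⇒ the environment is group-determined. [folklore] -/
theorem mem_groupDetermined_of_window (hL : 0 < L) (hK : 0 < K)
    (hsupp : ∀ B x, (∀ B', grp B' = grp B → x ∉ subCell (L / (K : ℝ)) B') → χ B x = 0)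
    (hwin : ∀ (B : SubIdx K) (X : Config (n + 1)), Φ X ≠ 0 → |smearedCount (χ B) X - c B| < τ)
    {B₀ : SubIdx K} {Y : Config n} (hY : smearedCount (χ B₀) Y ≤ c B₀ - τ) :
    Y ∈ groupDetermined L K grp Φ :=
  mem_groupDetermined.2 ⟨B₀, fun _ hB => blockMass_eq_zero_of_window hL hK hsupp hwin hY hB⟩

/-- A tagged particle in a CORE (`χ_{B₀}(x) = 1`) on the support of `Φ` leaves the others one smeared unit short of
the window of `B₀` (windows have width `2τ ≤ 1`). [folklore] -/
theorem smearedCount_le_of_core (hτ : 2 * τ ≤ 1)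
    (hwin : ∀ (B : SubIdx K) (X : Config (n + 1)), Φ X ≠ 0 → |smearedCount (χ B) X - c B| < τ) {B₀ : SubIdx K} {x : Space} {Y : Config n}
    (hx : χ B₀ x = 1) (h : Φ (Matrix.vecCons x Y) ≠ 0) : smearedCount (χ B₀) Y ≤ c B₀ - τ := by
  have hw := hwin B₀ _ h
  rw [smearedCount_vecCons, hx] at hw
  have := (abs_lt.1 hw).2
  linarith

/-- The core slice integral is dominated by the slice mass on the group-determined set:
`∫_{core} Φ(x,Y)² dx ≤ 1_A(Y) P̂(Y)`. [folklore] -/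
theorem coreIntegral_le_indicator (hL : 0 < L) (hK : 0 < K) (hχm : ∀ B, Measurable (χ B))
    (hsupp : ∀ B x, (∀ B', grp B' = grp B → x ∉ subCell (L / (K : ℝ)) B') → χ B x = 0) (hτ : 2 * τ ≤ 1)
    (hwin : ∀ (B : SubIdx K) (X : Config (n + 1)), Φ X ≠ 0 → |smearedCount (χ B) X - c B| < τ) (Y : Config n) :
    ∫⁻ x in coreSet K χ, ENNReal.ofReal (Φ (Matrix.vecCons x Y)) ^ 2 ≤
      (groupDetermined L K grp Φ).indicator (sliceSq Φ) Y := by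
  by_cases hY : Y ∈ groupDetermined L K grp Φ
  · rw [Set.indicator_of_mem hY]
    exact setLIntegral_le_lintegral _ _
  · rw [Set.indicator_of_notMem hY]
    refine le_of_eq (setLIntegral_eq_zero (measurableSet_coreSet hχm) fun x hx => ?_)
    obtain ⟨B₀, hB₀⟩ := Set.mem_iUnion.1 hx
    have hx1 : χ B₀ x = 1 := hB₀
    by_cases h : Φ (Matrix.vecCons x Y) = 0
    · simp [h]
    · exact absurd (mem_groupDetermined_of_window hL hK hsupp hwin (smearedCount_le_of_core hτ hwin hx1 h)) hY

/-- Off the group-determined set the slice carries NO core mass: `P̂(Y) = ∫_{coreᶜ} Φ(x,Y)² dx` for `Y ∉ A`.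
[folklore] -/
theorem sliceSq_eq_nonCore_of_not_mem (hL : 0 < L) (hK : 0 < K) (hχm : ∀ B, Measurable (χ B))
    (hsupp : ∀ B x, (∀ B', grp B' = grp B → x ∉ subCell (L / (K : ℝ)) B') → χ B x = 0) (hτ : 2 * τ ≤ 1)
    (hwin : ∀ (B : SubIdx K) (X : Config (n + 1)), Φ X ≠ 0 → |smearedCount (χ B) X - c B| < τ)
    {Y : Config n} (hY : Y ∉ groupDetermined L K grp Φ) :
    sliceSq Φ Y = ∫⁻ x in (coreSet K χ)ᶜ, ENNReal.ofReal (Φ (Matrix.vecCons x Y)) ^ 2 := by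
  have h0 : ∫⁻ x in coreSet K χ, ENNReal.ofReal (Φ (Matrix.vecCons x Y)) ^ 2 = 0 := by
    have h := coreIntegral_le_indicator hL hK hχm hsupp hτ hwin Y
    rw [Set.indicator_of_notMem hY] at h
    exact nonpos_iff_eq_zero.1 h
  unfold sliceSq
  rw [← lintegral_add_compl _ (measurableSet_coreSet hχm), h0, zero_add]

/-- The slice mass OFF the group-determined set is at most the non-core mass. [folklore] -/
theorem setLIntegral_sliceSq_compl_le_nonCoreMass (hL : 0 < L) (hK : 0 < K) (hΦm : Measurable Φ)
    (hχm : ∀ B, Measurable (χ B))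
    (hsupp : ∀ B x, (∀ B', grp B' = grp B → x ∉ subCell (L / (K : ℝ)) B') → χ B x = 0) (hτ : 2 * τ ≤ 1)
    (hwin : ∀ (B : SubIdx K) (X : Config (n + 1)), Φ X ≠ 0 → |smearedCount (χ B) X - c B| < τ) :
    ∫⁻ Y in (groupDetermined L K grp Φ)ᶜ, sliceSq Φ Y ≤ nonCoreMass K χ Φ := by
  have hA := measurableSet_groupDetermined L K grp hΦm
  calc ∫⁻ Y in (groupDetermined L K grp Φ)ᶜ, sliceSq Φ Y
      = ∫⁻ Y in (groupDetermined L K grp Φ)ᶜ, ∫⁻ x in (coreSet K χ)ᶜ, ENNReal.ofReal (Φ (Matrix.vecCons x Y)) ^ 2 :=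
        setLIntegral_congr_fun hA.compl fun Y hY => sliceSq_eq_nonCore_of_not_mem hL hK hχm hsupp hτ hwin hY
    _ ≤ nonCoreMass K χ Φ := setLIntegral_le_lintegral _ _

/-- **THE CERTIFICATE** (subtraction-free): for every `Φ` window-filtered on the smeared counts of super-blocks of
at most `m` blocks, `labelAffinity ≤ nonCoreMass + m^{1/2} K^{-3/2} · ∫ P̂` — the geometry of the others identifies
the group of every core particle, so the label affinity cannot exceed the non-core mass plus `m^{1/2} K^{-3/2}`
(`= (k/K)^{3/2}` for super-blocks of `k³` blocks); for normalised `Φ` with `nonCoreMass ≤ θ`: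
`labelAffinity ≤ θ + m^{1/2} K^{-3/2}`. [folklore] -/
theorem labelAffinity_le_nonCoreMass_add (hL : 0 < L) (hK : 0 < K) (hΦm : Measurable Φ)
    (hcard : ∀ B₀ : SubIdx K, (Finset.univ.filter fun B => grp B = grp B₀).card ≤ m)
    (hχm : ∀ B, Measurable (χ B))
    (hsupp : ∀ B x, (∀ B', grp B' = grp B → x ∉ subCell (L / (K : ℝ)) B') → χ B x = 0) (hτ : 2 * τ ≤ 1)
    (hwin : ∀ (B : SubIdx K) (X : Config (n + 1)), Φ X ≠ 0 → |smearedCount (χ B) X - c B| < τ) :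
    labelAffinity L K Φ ≤ nonCoreMass K χ Φ +
      (m : ℝ≥0∞) ^ (1 / 2 : ℝ) * blockWeight K * ∫⁻ Y : Config n, sliceSq Φ Y :=
  (labelAffinity_le_of_groupDetermined hL hK hΦm hcard).trans
    (add_le_add (setLIntegral_sliceSq_compl_le_nonCoreMass hL hK hΦm hχm hsupp hτ hwin)
      (mul_le_mul' le_rfl (setLIntegral_le_lintegral _ _)))

end Window

end Summit.AtomisticToContinuum.BoseEinsteinCondensation.Theorems.BoxCountShadow
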